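import Mathlib
import HarnessLib
import HarnessLib.Audit
import Summits.SmoothPoincare4.Statement
import Literature.Geometry.Lorentzian.LeviCivita

/-!
Route: InstantonEntropy

DORMANT since 2026-09-04T13:53:41Z (reconciler: no traction for 5 d (last activity item-evidence-added at 2026-08-30T13:18:22Z); parked, not closed — `ledger route dormant route-SmoothPoincare4-InstantonEntropy --off` to reactivate) — unstaffed, not closed; items shared with open routes are served there. `ledger route dormant <id> --off` reactivates.

# Route InstantonEntropy — maximum-entropy instantons — Ric > 0 on Σ plus a no-neck Morse theory of
the instanton density on M₁(Σ,g) recognises S⁴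

It suffices to show X = X_E ∧ X_R. X_E (ExistRicPos): every smooth homotopy 4-sphere Σ carries a
Riemannian metric with Ric > 0.
X_R (RicPosRecognition): a homotopy 4-sphere carrying a metric with Ric > 0 is diffeomorphic to S⁴.
The card's ENGINE for X_R —
and the point of the route — is the ENTROPY OF THE INSTANTON DENSITY: for generic g the function
S(A) = ∫_Σ |F_A|² log|F_A|² dvol_g
on the charge-one ASD moduli space M₁(Σ,g) (a smooth 5-manifold whose only end is the
Donaldson–Taubes collar Σ × (0,λ₀)) is smooth,
proper, bounded below and collar-monotone (CollarMonotone); if every critical point of S is a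
nondegenerate local minimum
(LocalMinRicPos = the NO-NECK conjecture under Ric > 0) the mountain-pass lemma leaves exactly one
critical point, and the gradient
flow of S isotopes far level sets (≅ Σ) onto near-minimum level sets (≅ S⁴ by the Morse lemma), so Σ
≅ S⁴ (MorseMountainPass) —
a diffeomorphism produced by an explicit flow, not by the h-cobordism principle. In the conformally
round class g = e^(2u)·g₀ on S⁴
the whole Morse theory is explicit potential theory on ℍ⁵: M₁ = B⁵, S = 8π²(Ent − 4·P_h[u]) + const
with K_ζ(x) = ((1−|ζ|²)/|x−ζ|²)⁴
the hyperbolic Poisson kernel, Ent(ζ) = ⨍ K_ζ log K_ζ = −⨍ log K_ζ and P_h[u] the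
hyperbolic-harmonic extension of u; there NO-NECK
is the typed real-analysis crux NoNeckConformal, flanked by the provable supports
RoundEntropyClosedForm / RoundEntropyUnique /
SmallOscUnique. Realises card instanton-entropy-mountain-pass (spine; it absorbed the retired
sibling instanton-moduli-ball-half-pic).
The gauge-theoretic items (LocalMinRicPos, CollarMonotone cruxes; EntropyModuliPlatform,
MorseMountainPass supports) are filed
informal after open because Lean has no ASD moduli space yet (definition request AsdModuliSpace).
Lean: `(∀ (M : Type) [TopologicalSpace M] [T2Space M] [SecondCountableTopology M] [ChartedSpace
(EuclideanSpace ℝ (Fin 4)) M] [IsManifold (𝓡 4) ((⊤ : ℕ∞) : WithTop ℕ∞) M], M ≃ₕ Metric.sphere (0 :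
EuclideanSpace ℝ (Fin 5)) 1 → ∃ g : Literature.Geometry.Lorentzian.PseudoRiemannianMetric (𝓡 4) ((⊤
: ℕ∞) : WithTop ℕ∞) (EuclideanSpace ℝ (Fin 4)) (TangentSpace (𝓡 4) : M → Type _), ∃ _ :
g.HasLeviCivita, g.IsRiemannian ∧ ∀ (x : M) (v : TangentSpace (𝓡 4) x), v ≠ 0 → 0 < g.ricci x v v) ∧
(∀ (M : Type) [TopologicalSpace M] [T2Space M] [SecondCountableTopology M] [ChartedSpace
(EuclideanSpace ℝ (Fin 4)) M] [IsManifold (𝓡 4) ((⊤ : ℕ∞) : WithTop ℕ∞) M], M ≃ₕ Metric.sphere (0 :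
EuclideanSpace ℝ (Fin 5)) 1 → (∃ g : Literature.Geometry.Lorentzian.PseudoRiemannianMetric (𝓡 4) ((⊤
: ℕ∞) : WithTop ℕ∞) (EuclideanSpace ℝ (Fin 4)) (TangentSpace (𝓡 4) : M → Type _), ∃ _ :
g.HasLeviCivita, g.IsRiemannian ∧ ∀ (x : M) (v : TangentSpace (𝓡 4) x), v ≠ 0 → 0 < g.ricci x v v) →
Nonempty (Diffeomorph (𝓡 4) (𝓡 4) M (Metric.sphere (0 : EuclideanSpace ℝ (Fin 5)) 1) ((⊤ : ℕ∞) :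
WithTop ℕ∞)))`

## Assembly
Pure logic, nothing else: ExistRicPos and RicPosRecognition are quantified over exactly the carriers
`SmoothPoincare4` quantifies
over (M Hausdorff, second countable, a C^∞ 4-manifold on ℝ⁴, with a homotopy equivalence M ≃ₕ S⁴),
so `closes` is
`intro M … e; exact hR M e (hE M e)` (3 lines, axioms propext/Classical.choice/Quot.sound; folder
Sketch.lean). Compactness and
orientability of such an M are PROVED Literature theorems
(`compactSpace_of_homotopyEquiv_sphere_four_holds`,
`isOrientable_of_homotopyEquiv_sphere_four_holds`) available to any prover who wants them, but they
are no longer needed by the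
glue and `HomotopySphere 4` is no longer mentioned: rev 2 (route-repair, cone) removed every
Literature import except
`Literature.Geometry.Lorentzian.LeviCivita` (metric/Levi-Civita/Ricci interface, all of whose named
facts are discharged), so no
unproved named fact of the tree enters this route's own import cone; the statements are equivalent
to rev 1's (folder CheckHS.lean,
CheckRound.lean, farm rc 0).

Rationale: WHY THIS LINE. Among all regimes of Yang–Mills theory, charge one on a definite (here b₂ = 0)
manifold is the one where the TOPOLOGY of a moduli
space, not a number extracted from it, constrains smooth structure (Donaldson1983; Taubes1982
existence; FreedUhlenbeck1984 generic
smoothness; Uhlenbeck1982 compactness): for a homotopy 4-sphere M₁(Σ,g) is a 5-manifold with one end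
Σ × (0,λ₀)
(GordonKirby1984, Taubes' survey Thms 2.6–2.7) and nothing is known about its interior. The card
puts a canonical proper Morse
function on it — the Shannon entropy of the curvature density, which blows up like 32π² log(1/λ) in
the collar — and imports
three outside toolboxes with an explicit dictionary: hyperbolic potential theory (on round S⁴ the
instanton density IS the
Poisson kernel of ℍ⁵, the oldest AdS₅/CFT₄ entry, BianchiEtAl1998, ChuHoWu1999, Stoll2016 (5.1.5)),
finite-dimensional critical
point theory (mountain pass for proper functions, AmbrosettiRabinowitz1973; regular-interval
theorem, Matsumoto2001 Thm 2.31/3.1),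
and comparison geometry of Ric > 0 (warped products with Ric > 0 have concave warping, i.e. no
necks; ShaYang1991, Wraith1998 for
the existence side). What prior routes do not do: PIC (route-SmoothPoincare4-PIC) recognises S⁴ by
Ricci flow with surgery and
needs PIC pointwise; here recognition is a Morse-theoretic statement about ONE auxiliary 5-manifold
and the curvature hypothesis
is Ric > 0, with a solvable model (conformally round classes) in which the conjecture is a checkable
statement about harmonic
functions on the 5-ball; the negatives index is empty. Spectral/probabilistic reformulations were
considered and not used: the
entropy functional is the only ingredient borrowed from information theory (its Hessian's first term
is the
Groisser–Murray/Hitchin information metric, GroisserMurray1997, arXiv:hep-th/0108122).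

RANKED CRUXES. #0 Thesis (target) — X = ExistRicPos ∧ RicPosRecognition (typed level of the thesis;
the entropy engine lives in the informal children of RicPosRecognition). (why it might fail: X_R ⇔
SPC4 restricted to Ric>0 spheres and X_E ≥ PSC-hard; the engine can die (a Ric>0 metric with a
saddle instanton) while X stays open.) [Donaldson1983, Taubes1982, FreedUhlenbeck1984,
BianchiEtAl1998, Hamilton1997]
#2 NoNeckConformal (crux) — NO-NECK in the solvable model (card §3(c)): for every u on S⁴ such that
e^(2u)·g_round has Ric > 0, the model entropy F_u(ζ) = ⨍ K_ζ log K_ζ dσ̄ − 4 ⨍ K_ζ u dσ̄ (K_ζ(x) =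
((1−|ζ|²)/|x−ζ|²)⁴, σ̄ = normalised measure of S⁴ ⊂ ℝ⁵) is C² on the open unit 5-ball and has
exactly one critical point there, a nondegenerate minimum. By conformal invariance and the
Poisson-kernel identity this IS 'S has a unique nondegenerate critical point on M₁(S⁴, e^(2u)g₀)'.
[difficulty: L] (why it might fail: Finite margin: for u = h·x₅² a second axis well appears at h ≈
0.90 while Ric > 0 only caps h < 0.5 (ratio 1.8; football direction 3.55 vs 0.25); a lopsided
two-bump factor inside Ric > 0 might still dig twin wells through higher-order terms.) [Stoll2016,
BianchiEtAl1998, AtiyahHitchinSinger1978, GordonKirby1984, Besse1987]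
#3 RicPosRecognition (crux) — every homotopy 4-sphere that carries a Riemannian metric of positive
Ricci curvature is diffeomorphic to S⁴ — the Riemannian-level deliverable of the entropy engine
(CollarMonotone → LocalMinRicPos → MorseMountainPass over the platform facts), stated so that it
closes the route with ExistRicPos today and splits into its gauge-theoretic children once
AsdModuliSpace is definable. [deps: NoNeckConformal] [difficulty: open-problem] (why it might fail:
False iff an exotic homotopy 4-sphere carries Ric > 0 (nothing known forbids it: b₂ = 0, σ = 0,
spin, all index/SW obstructions silent); and the engine may die first — Ric > 0 could admit a fat
neck with a saddle instanton.) [Donaldson1983, Taubes1982, FreedUhlenbeck1984, GroisserParker1989,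
AmbrosettiRabinowitz1973, Matsumoto2001, Hamilton1997]
#4 ExistRicPos (crux) — every smooth homotopy 4-sphere admits a Riemannian metric with Ric > 0 (card
EXIST-RIC; existence side, weaker pointwise than PIC/¼-pinching, stronger than the PSC crux of route
PIC). [difficulty: open-problem] (why it might fail: At least PSC-hard: Σ comes from S⁴ by
codimension-2 surgeries (h-cobordism 3-handles, Gluck regluing) where Ric > 0 surgery (Sha–Yang,
Wraith: codim ≥ 3 with extra hypotheses) is unavailable; an exotic Σ may simply carry no such
metric.) [ShaYang1991, Wraith1998, Hamilton1997, arXiv:2501.01113, arXiv:2507.15719]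
#9 RoundEntropyClosedForm (support) — Möbius change of variables (Stoll (5.3.1): ∫ f∘φ_a dσ = ∫
P_h(a,·) f dσ, and J_(φ_a) = P_h(a,·)): for ζ in the open unit 5-ball, ⨍ K_ζ log K_ζ dσ̄ = − ⨍ log
K_ζ dσ̄. Verified numerically to 1e-12 this session; it makes Ent explicitly radial-monotone (−log
K_ζ = −4 log(1−|ζ|²) + 4 log|x−ζ|², spherical mean of a subharmonic function). [difficulty: M]
[Stoll2016]
#9 RoundEntropyUnique (support) — ROUND case (card §2, Jensen + radial monotonicity): Ent(ζ) = ⨍ K_ζ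
log K_ζ dσ̄ is C² on the open 5-ball, its only critical point there is ζ = 0, and the Hessian at 0
is positive definite (= 12.8·Id numerically; Ent = 6.4|ζ|² + O(|ζ|⁴)). This is 'S has a unique
nondegenerate critical point on M₁(S⁴, round)'. [difficulty: M] [Stoll2016, AtiyahHitchinSinger1978,
BianchiEtAl1998]
#9 SmallOscUnique (support) — SMALL-OSC (card §3(a)): there is c₀ > 0 such that for every continuous
u on S⁴ with |u| ≤ c₀ the model entropy F_u has exactly one critical point in the open 5-ball, a
nondegenerate minimum (interior gradient/Hessian estimates for hyperbolic-harmonic extensions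
against the uniformly convex radial profile of Ent; all critical points are confined to hyperbolic
distance O(c₀) of 0). [difficulty: L] [Stoll2016, GroisserParker1987]

TWO-LAYER PLAN. RicPosRecognition ⇐ CollarMonotone → LocalMinRicPos → RicPosRecognition, glue =
MorseMountainPass over the EntropyModuliPlatform
facts (Taubes existence, Uhlenbeck compactness + Donaldson collar, Freed–Uhlenbeck genericity,
conformal invariance, AHS/ADHM
M₁(S⁴) = B⁵) — filed informal now, typed once definition request AsdModuliSpace lands.
NoNeckConformal ⇐ ZonalNoNeck (SO(4)-invariant
u: a one-variable statement, Ric > 0 ⇔ (sin θ·ψ′)′ < sin θ ∧ ψ″ + 5 cot θ·ψ′ + 2ψ′² < 3) →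
AxisReduction (critical points of
SO(4)-invariant F_u lie on the axis) → NoNeckConformal restricted, then the general case by a
separate estimate. ExistRicPos is not
split before a construction mechanism across codimension-2 necks is named.

KILL CRITERIA. NoNeckConformal refuted (a conformal factor with Ric > 0 and two entropy wells) kills
NO-NECK(Ric > 0) inside its own solvable model:
pivot within one edit by restating NoNeckConformal / RicPosRecognition / ExistRicPos over a smaller
natural class (sec > 0,
Ric ≥ ε·scal·g, or ¼-pinched) if the refuting family respects one; if no natural class survives a
kit sweep, close
`refuted:NoNeckConformal`. LocalMinRicPos refuted by an explicit Ric > 0 metric on S⁴ with a saddle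
instanton: same pivot.
ExistRicPos refuted = an exotic 4-sphere exists (route closes with the problem, negatively decided).
RicPosRecognition or SPC4 proved
by other means moots the engine but not the items. A theorem forcing ≥ 2 critical points of S on
every M₁(Σ,g) is excluded by the
round case (RoundEntropyUnique), so it is not a kill scenario.

NOT DECOMPOSED YET. CONNECTED (M₁ connected for generic g) is NOT an item: under LocalMinRicPos a
compact component would carry a maximum, so
connectedness of the collar component is automatic (novelty-audit caveat adopted). Also deferred:
the Kuranishi second-order term in
Hess S; the L^p family f_p = ‖F_A‖_p^p (S = ∂_p f_p at p = 2) as alternative Morse functions;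
uniform collar constants λ₁(g); the
vendoring of Taubes/Uhlenbeck/Donaldson/Freed–Uhlenbeck as cite facts (blocked on AsdModuliSpace);
ADHM-continuation numerics for
metrics on S⁴ far from round; any use of CONNECTED as a stand-alone gauge-theory question.

CHEAPEST FALSIFIER. A kit sweep of NoNeckConformal: zonal factors u = ψ(θ) and two-bump factors
subject to the explicit Ric > 0 inequalities, counting
critical points of F_u = Ent − 4·P_h[u] on B⁵ (one 1-D quadrature per evaluation). Run by hand this
session (pure-python graded
Gauss quadrature, folder NOTES.md): ℓ = 2 zonal family u = h·x₅² — second axis well first at h ≈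
0.90 (origin bifurcation at
6.4/7.31 = 0.875) versus Ric > 0 cap h < 0.5; football direction u = −k·x₅² — k ≈ 3.55 versus cap
0.25; Ent strictly increasing and
convex in hyperbolic distance with dEnt/dt ↑ 4, Ent = 6.4|ζ|² + O(|ζ|⁴); closed form Ent = −⨍ log
K_ζ confirmed to 1e-12. So the
line survives its cheapest test with margin 1.8; the next cheapest is the same sweep over non-zonal
two-bump factors.

NUMBERS. Mass ∫|F_A|² = 8π² (k = 1); |S⁴| = 8π²/3; K_ζ(x) = ((1−|ζ|²)/|x−ζ|²)⁴ with ⨍ K_ζ dσ̄ = 1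
(Stoll2016 (5.1.5), Lemma 5.3.1); S = 8π²·F_u +
const, F_u = Ent − 4·P_h[u]; Ent = 6.4 r² + O(r⁴) = 1.6 t² + O(t⁴) (t = hyperbolic distance),
dEnt/dt ∈ (0,4), ↑ 4 (card: S₀′ ↑ 32π²);
collar asymptotics S = 32π² log(1/λ) + O(1); Ric(e^(2u)g₀) = 3g₀ − 2(∇²u − du⊗du) − (Δu + 2|du|²)g₀
on S⁴ (Besse1987 1.159);
thresholds: h* ≈ 0.90 vs 0.5, k* ≈ 3.55 vs 0.25. Items at open: 9 typed (1 target, 3 cruxes, 3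
supports, 1 assembly) + 4 informal
filed after open (2 cruxes, 2 supports) = 13 ≤ 15.

DEFINITION REQUESTS. D1 `AsdModuliSpace` (topic Literature/Geometry/GaugeTheory): for a closed
oriented Riemannian 4-manifold (X,g) and the SU(2)-bundle
with c₂ = k, the space of g-anti-self-dual connections modulo gauge, with the Freed–Uhlenbeck
theorem that for generic g and
b₂⁺ = 0… (here b₂ = 0) it is a smooth 5-manifold (k = 1) away from reducibles — needed to type
LocalMinRicPos, CollarMonotone,
EntropyModuliPlatform, MorseMountainPass. D2 `instantonEntropy` S(A) = ∫ |F_A|² log(|F_A|²) dvol_g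
on D1. Cite facts wanted once D1
lands: Taubes1982 (existence, k = 1), Uhlenbeck1982 (compactness/removable singularities),
Donaldson1983 (collar Σ × (0,λ₀), one
end), FreedUhlenbeck1984 (generic-metric smoothness, no reducibles when b₂ = 0),
AtiyahHitchinSinger1978 + GordonKirby1984 Thm 2.10
(M₁(S⁴) = B⁵), BianchiEtAl1998 (density of the ζ-instanton on round S⁴ = 8π²·K_ζ·σ̄). No new
Riemannian definitions are needed:
`PseudoRiemannianMetric.ricci`, `HasLeviCivita` (LeviCivita.lean) carry every typed item; since rev
2 (cone repair) the round
metric in NoNeckConformal is written inline as the pullback ⟪dι·, dι·⟫ of the Euclidean inner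
product along ι : S⁴ ↪ ℝ⁵
(= `roundMetric` by `roundMetric_apply`, RoundSphere.lean not imported because it drags
RicciFlow.lean's undischarged Hamilton facts
into the cone) and the homotopy 4-spheres are bare carriers as in the Statement
(HomotopySpheres.lean not imported: its cone carries
Freedman / Smale h-cobordism / Kervaire–Milnor / cobordism-transitivity facts this line never uses).
needs-fact: none. The only
undischarged facts left in the file-level cone ride on the operator's
`Summits.SmoothPoincare4.SmoothPoincare4.Statement` →
`Literature.Topology.FourManifolds.SPC4Wave0` import (Freedman, Perelman, Milnor S⁷, exotic ℝ⁴, …),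
shared by every route of the summit
and not load-bearing here.

Novelty: Searches (2026-08-15): `lit search --hybrid "entropy of instanton curvature density moduli space
Morse function"` (12 book hits:
gordon1984, donaldson1991, morgan1996, manton2004 … — none on entropy/Morse functions on M₁); `lit
search --source crossref
"information metric instanton moduli space"` (8: Habermann1993 doi:10.1007/bf00773547, Yahikozawa
2004 doi:10.1103/physreve.69.026122,
…); `… "Riemannian geometry of the Yang-Mills moduli space Groisser Parker"` (6:
GroisserParker1987/1989/1997, Groisser 1993
doi:10.4310/cag.1993.v1.n2.a1); `… "path-connected Yang-Mills moduli spaces"` (8: Taubes1984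
doi:10.4310/jdg/1214438683, Taubes 1989
doi:10.4310/jdg/1214442641); `… "Yang-Mills instanton AdS5 D-instanton bulk-to-boundary"` (6:
ChuHoWu1999, Bianchi–Green–Kovacs
2002); `lit search --source zbmath "Morse theory Yang-Mills moduli space functional instantons
critical points four-sphere"` (0);
`lit search --source zbmath "positive Ricci curvature homotopy 4-sphere"` (2:
doi:10.1090/s0273-0979-08-01213-5, arXiv:2507.15719);
`lit frontier SmoothPoincare4 --since 2020` (30 rows; gauge theory only as families invariants
arXiv:2604.15087/2604.15071, nothing on
moduli-space Morse theory); `lit bridges SmoothPoincare4 --cross any` (no gauge/potential-theory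
bridge); `lit galaxy search
"moduli space of instantons" --star all` (17 rows: Freed–Uhlenbeck MSRI vol.,
Braverman–Finkelberg–Nakajima arXiv:1406.2381,
"Deformations of instanton metrics" arXiv:2208.14936, physics texts — nothing o  [refs: 10.1007/bf00773547, 10.1103/physreve.69.026122, 10.4310/cag.1993.v1.n2.a1, 10.4310/jdg/1214438683, 10.4310/jdg/1214442641, 10.1090/s0273-0979-08-01213-5, 10.1088/1126-6708/1998/08/013, 10.1023/a:1006560802410, 2507.15719, 2604.15087, 1406.2381, 2208.14936, hep-th/0108122, doi:10.1007/bf00773547, doi:10.1103/physreve.69.026122, doi:10.4310/cag.1993.v1.n2.a1, doi:10.4310/jdg/1214438683, doi:10.4310/]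

Barriers (technique_class: instanton moduli; entropy Morse theory; Ric positive): - technique_class: instanton moduli; entropy Morse theory; Ric positive
- Literature.Barriers.SmoothPoincare4.GaugeSumBarrierFour: evaded by construction — no VALUE of a
gauge invariant is compared across manifolds (such values are forced at b₂⁺ = 0); M₁(Σ,g) enters as
a 5-manifold WITH A FUNCTION in the one regime (k = 1, definite/b₂ = 0) where moduli topology does
constrain smooth structure (Donaldson1983); S(A_min) is never used as an invariant.
- Literature.Barriers.SmoothPoincare4.HCobordismBarrierFour: the region between a far level set (≅
Σ) and a near-minimum level set (≅ S⁴) IS a smooth h-cobordism inside M₁; it is trivialised by the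
gradient flow of S (no critical points in between, Matsumoto Thm 2.31), a specific analytic reason,
never by the general h-cobordism ⇒ product principle that Donaldson broke.
- Literature.Barriers.SmoothPoincare4.HCobordismInvariantBarrierFour: not engaged — nothing factors
through the h-cobordism class of Σ.
- Literature.Barriers.SmoothPoincare4.StableBarrierFour: not engaged — no stabilisation; M₁ of Σ #
S²×S² is a different, reducible-laden space and is never used.
- Literature.Barriers.SmoothPoincare4.TopologicalBarrierFour: not engaged — (M₁(Σ,g), S) depends on
the smooth structure and the metric, not on the homeomorphism type.
- Literature.Barriers.SmoothPoincare4.CircleActionBarrierFour: the warning applies to the MODEL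
only: uniqueness on (S⁴,[g₀]) is read off SO(5)-symmetry + Jensen; for an unknown Σ no symmetry is
assumed, whic

History (route lifecycle, newest last):
- 2026-08-15T16:53:21Z · rev 2: restated Thesis (stmt-SmoothPoincare4-6233), NoNeckConformal (stmt-SmoothPoincare4-6234), RicPosRecognition (stmt-SmoothPoincare4-6235), ExistRicPos (stmt-SmoothPoincare4-6236) — route-repair (cone): RE-ROUTED AROUND all 18 import-closure facts of the payload; needs-fact: none. 4 imports dropped (Literature.Geom (planner-rrepair-SmoothPoincare4-InstantonEntro-d0a3886e-0)
- 2026-08-23T18:01:44Z · DORMANT — reconciler: no traction for 6.1 d (last activity item-evidence-added at 2026-08-17T13:46:06Z); parked, not closed — `ledger route dormant route-SmoothPoincare4- (operator:999:2014555)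
- 2026-08-30T07:11:28Z · REACTIVATED — reconciler: reactivated — activity statement-attached at 2026-08-30T06:28:07Z after parking at 2026-08-23T18:01:44Z (operator:999:397448)
- 2026-09-04T13:53:41Z · DORMANT — reconciler: no traction for 5 d (last activity item-evidence-added at 2026-08-30T13:18:22Z); parked, not closed — `ledger route dormant route-SmoothPoincare4-In (operator:999:60818)

sub-problem: SmoothPoincare4 · status: dormant · opened planner-plancard-SmoothPoincare4-SmoothPoinca-211502ba-0 2026-08-15T11:45:14Z · rev 2 · ledger route-SmoothPoincare4-InstantonEntropy
GENERATED by the gate from the ledger (D-0016/17). Provers cite these decls: `theorem foo : Summit.SmoothPoincare4.SmoothPoincare4.Theses.InstantonEntropy.<Decl> := …` in Summits/SmoothPoincare4/SmoothPoincare4/Theorems/<Name>.lean.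
-/

namespace Summit.SmoothPoincare4.SmoothPoincare4.Theses.InstantonEntropy

open scoped BigOperators Topology Manifold Classical MeasureTheory ProbabilityTheory Matrix InnerProductSpace ComplexConjugate ContinuousMap ContDiff
open Filter Set Function TopologicalSpace MeasureTheory

attribute [summit_statement] _root_.SmoothPoincare4

open Literature.SPC4

-- earlier Thesis (stmt-SmoothPoincare4-6233, replaced 2026-08-15T16:53:21Z -> stmt-SmoothPoincare4-11177): retired by None — (∀ S : Literature.Topology.FourManifolds.HomotopySphere 4, ∃ g : Literature.Geometry.Lorentzian.PseudoRiemannianMetric (𝓡 4) ∞ (EuclideanSpace ℝ (Fin 4)) (TangentSpace (𝓡 4) : S.carrier → Type _), ∃ _ : g.HasLeviCivita, g.IsRiemannian ∧ ∀ (x : S.carrier) (v : TangentSpace (𝓡 4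
/-- item stmt-SmoothPoincare4-11177 · target · rank 0 · open · by planner
why it might fail: X_R ⇔ SPC4 restricted to Ric>0 spheres and X_E ≥ PSC-hard; the engine can die (a Ric>0 metric with a saddle instanton) while X stays open.
sources: Donaldson1983, Taubes1982, FreedUhlenbeck1984, BianchiEtAl1998, Hamilton1997
[target] X = ExistRicPos ∧ RicPosRecognition (typed level of the thesis; the entropy engine lives in
the informal children of RicPosRecognition). Quantified over bare homotopy 4-spheres (M Hausdorff,
second countable, C^∞ 4-manifold on ℝ⁴, M ≃ₕ S⁴) exactly as `SmoothPoincare4` does; such M is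
compact and orientable by the PROVED facts
compactSpace_/isOrientable_of_homotopyEquiv_sphere_four_holds, so this is equivalent to the rev-1
`HomotopySphere 4` form (folder CheckHS.lean) while keeping HomotopySpheres.lean and its
Freedman/Smale/Kervaire–Milnor facts out of the route's cone (route-repair rev 2). -/
@[route_item "route-SmoothPoincare4-InstantonEntropy"]
def Thesis : Prop :=
  (∀ (M : Type) [TopologicalSpace M] [T2Space M] [SecondCountableTopology M] [ChartedSpace (EuclideanSpace ℝ (Fin 4)) M] [IsManifold (𝓡 4) ((⊤ : ℕ∞) : WithTop ℕ∞) M], M ≃ₕ Metric.sphere (0 : EuclideanSpace ℝ (Fin 5)) 1 → ∃ g : Literature.Geometry.Lorentzian.PseudoRiemannianMetric (𝓡 4) ((⊤ : ℕ∞) : WithTop ℕ∞) (EuclideanSpace ℝ (Fin 4)) (TangentSpace (𝓡 4) : M → Type _), ∃ _ : g.HasLeviCivita, g.IsRiemannian ∧ ∀ (x : M) (v : TangentSpace (𝓡 4) x), v ≠ 0 → 0 < g.ricci x v v) ∧ (∀ (M : Type) [TopologicalSpace M] [T2Space M] [SecondCountableTopology M] [ChartedSpace (EuclideanSpace ℝ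 (Fin 4)) M] [IsManifold (𝓡 4) ((⊤ : ℕ∞) : WithTop ℕ∞) M], M ≃ₕ Metric.sphere (0 : EuclideanSpace ℝ (Fin 5)) 1 → (∃ g : Literature.Geometry.Lorentzian.PseudoRiemannianMetric (𝓡 4) ((⊤ : ℕ∞) : WithTop ℕ∞) (EuclideanSpace ℝ (Fin 4)) (TangentSpace (𝓡 4) : M → Type _), ∃ _ : g.HasLeviCivita, g.IsRiemannian ∧ ∀ (x : M) (v : TangentSpace (𝓡 4) x), v ≠ 0 → 0 < g.ricci x v v) → Nonempty (Diffeomorph (𝓡 4) (𝓡 4) M (Metric.sphere (0 : EuclideanSpace ℝ (Fin 5)) 1) ((⊤ : ℕ∞) : WithTop ℕ∞)))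

-- earlier NoNeckConformal (stmt-SmoothPoincare4-6234, replaced 2026-08-15T16:53:21Z -> stmt-SmoothPoincare4-11178): retired by None — let K : EuclideanSpace ℝ (Fin 5) → Metric.sphere (0 : EuclideanSpace ℝ (Fin 5)) 1 → ℝ := fun ζ x => ((1 - ‖ζ‖ ^ 2) / ‖(x : EuclideanSpace ℝ (Fin 5)) - ζ‖ ^ 2) ^ 4; let F : (Metric.sphere (0 : EuclideanSpace ℝ (Fin 5)) 1 → ℝ) → EuclideanSpace ℝ (Fin 5) → ℝ := fun u ζ =
/-- item stmt-SmoothPoincare4-11178 · crux · rank 2 · open · by planner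
why it might fail: Finite margin: for u = h·x₅² a second axis well appears at h ≈ 0.90 while Ric > 0 only caps h < 0.5 (ratio 1.8; football direction 3.55 vs 0.25); a lopsided two-bump factor inside Ric > 0 might still dig twin wells through higher-order terms.
sources: Stoll2016, BianchiEtAl1998, AtiyahHitchinSinger1978, GordonKirby1984, Besse1987
[crux] NO-NECK in the solvable model (card §3(c)): for every u on S⁴ such that e^(2u)·g_round has
Ric > 0, the model entropy F_u(ζ) = ⨍ K_ζ log K_ζ dσ̄ − 4 ⨍ K_ζ u dσ̄ (K_ζ(x) = ((1−|ζ|²)/|x−ζ|²)⁴,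
σ̄ = normalised measure of S⁴ ⊂ ℝ⁵) is C² on the open unit 5-ball and has exactly one critical point
there, a nondegenerate minimum. By conformal invariance and the Poisson-kernel identity this IS 'S
has a unique nondegenerate critical point on M₁(S⁴, e^(2u)g₀)'. The round metric is written inline
as the pullback ⟪dι_y v, dι_y w⟫ of the Euclidean inner product of ℝ⁵ along the inclusion ι : S⁴ ↪
ℝ⁵ (dι = mfderiv (𝓡 4) (𝓡 5) Subtype.val) — literally `Literature.Geometry.Riemannian.roundMetric`
by `roundMetric_apply` (folder CheckRound.lean), RoundSphere.lean being kept out of the cone because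
it imports RicciFlow.lean (route-repair rev 2). [difficulty: L] -/
@[route_item "route-SmoothPoincare4-InstantonEntropy"]
def NoNeckConformal : Prop :=
  let K : EuclideanSpace ℝ (Fin 5) → Metric.sphere (0 : EuclideanSpace ℝ (Fin 5)) 1 → ℝ := fun ζ x => ((1 - ‖ζ‖ ^ 2) / ‖(x : EuclideanSpace ℝ (Fin 5)) - ζ‖ ^ 2) ^ 4; let F : (Metric.sphere (0 : EuclideanSpace ℝ (Fin 5)) 1 → ℝ) → EuclideanSpace ℝ (Fin 5) → ℝ := fun u ζ => (⨍ x, K ζ x * Real.log (K ζ x) ∂(volume : Measure (EuclideanSpace ℝ (Fin 5))).toSphere) - 4 * ⨍ x, K ζ x * u x ∂(volume : Measure (EuclideanSpace ℝ (Fin 5))).toSphere; ∀ (u : Metric.sphere (0 : EuclideanSpace ℝ (Fin 5)) 1 → ℝ) (g : Literature.Geometry.Lorentzian.PseudoRiemannianMetric (𝓡 4) ((⊤ : ℕ∞) : WithTop ℕ∞) (EuclideanSpace ℝ (Fin 4)) (TangentSpace (𝓡 4) : Metric.sphere (0 : EuclideanSpace ℝ (Fin 5)) 1 → Type _)) (_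 : g.HasLeviCivita), (∀ (y : Metric.sphere (0 : EuclideanSpace ℝ (Fin 5)) 1) (v w : TangentSpace (𝓡 4) y), g.val y v w = Real.exp (2 * u y) * @inner ℝ (EuclideanSpace ℝ (Fin 5)) _ (mfderiv (𝓡 4) (𝓡 5) (Subtype.val : Metric.sphere (0 : EuclideanSpace ℝ (Fin 5)) 1 → EuclideanSpace ℝ (Fin 5)) y v) (mfderiv (𝓡 4) (𝓡 5) (Subtype.val : Metric.sphere (0 : EuclideanSpace ℝ (Fin 5)) 1 → EuclideanSpace ℝ (Fin 5)) y w)) → (∀ (y : Metric.sphere (0 : EuclideanSpace ℝ (Fin 5)) 1) (v : TangentSpace (𝓡 4) y), v ≠ 0 → 0 < g.ricci y v v) → ContDiffOn ℝ 2 (F u) (Metric.ball (0 : EuclideanSpace ℝ (Fin 5)) 1) ∧ ∃ ζ₀ ∈ Metric.ball (0 : EuclideanSpace ℝ (Fin 5)) 1, fderiv ℝ (F u) ζ₀ = 0 ∧ (∀ v : EuclideanSpace ℝ (Fin 5), v ≠ 0 → 0 < fderiv ℝ (fderiv ℝ (F u)) ζ₀ v v) ∧ ∀ ζ ∈ Metric.ball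 (0 : EuclideanSpace ℝ (Fin 5)) 1, fderiv ℝ (F u) ζ = 0 → ζ = ζ₀

-- earlier RicPosRecognition (stmt-SmoothPoincare4-6235, replaced 2026-08-15T16:53:21Z -> stmt-SmoothPoincare4-11179): retired by None — ∀ S : Literature.Topology.FourManifolds.HomotopySphere 4, (∃ g : Literature.Geometry.Lorentzian.PseudoRiemannianMetric (𝓡 4) ∞ (EuclideanSpace ℝ (Fin 4)) (TangentSpace (𝓡 4) : S.carrier → Type _), ∃ _ : g.HasLeviCivita, g.IsRiemannian ∧ ∀ (x : S.carrier) (v : Tangen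
/-- item stmt-SmoothPoincare4-11179 · crux · rank 3 · open · by planner
why it might fail: False iff an exotic homotopy 4-sphere carries Ric > 0 (nothing known forbids it: b₂ = 0, σ = 0, spin, all index/SW obstructions silent); and the engine may die first — Ric > 0 could admit a fat neck with a saddle instanton.
sources: Donaldson1983, Taubes1982, FreedUhlenbeck1984, GroisserParker1989, AmbrosettiRabinowitz1973, Matsumoto2001
[crux] every homotopy 4-sphere that carries a Riemannian metric of positive Ricci curvature is
diffeomorphic to S⁴ — the Riemannian-level deliverable of the entropy engine (CollarMonotone →
LocalMinRicPos → MorseMountainPass over the platform facts), stated so that it closes the route with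
ExistRicPos today and splits into its gauge-theoretic children once AsdModuliSpace is definable.
Quantified over bare homotopy 4-spheres (M Hausdorff, second countable, C^∞ 4-manifold on ℝ⁴, M ≃ₕ
S⁴) exactly as `SmoothPoincare4` does; such M is compact and orientable by the PROVED facts
compactSpace_/isOrientable_of_homotopyEquiv_sphere_four_holds, so this is equivalent to the rev-1
`HomotopySphere 4` form (folder CheckHS.lean) while keeping HomotopySpheres.lean and its
Freedman/Smale/Kervaire–Milnor facts out of the route's cone (route-repair rev 2). [deps:
NoNeckConformal] [difficulty: open-problem] -/
@[route_item "route-SmoothPoincare4-InstantonEntropy"]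
def RicPosRecognition : Prop :=
  ∀ (M : Type) [TopologicalSpace M] [T2Space M] [SecondCountableTopology M] [ChartedSpace (EuclideanSpace ℝ (Fin 4)) M] [IsManifold (𝓡 4) ((⊤ : ℕ∞) : WithTop ℕ∞) M], M ≃ₕ Metric.sphere (0 : EuclideanSpace ℝ (Fin 5)) 1 → (∃ g : Literature.Geometry.Lorentzian.PseudoRiemannianMetric (𝓡 4) ((⊤ : ℕ∞) : WithTop ℕ∞) (EuclideanSpace ℝ (Fin 4)) (TangentSpace (𝓡 4) : M → Type _), ∃ _ : g.HasLeviCivita, g.IsRiemannian ∧ ∀ (x : M) (v : TangentSpace (𝓡 4) x), v ≠ 0 → 0 < g.ricci x v v) → Nonempty (Diffeomorph (𝓡 4) (𝓡 4) M (Metric.sphere (0 : EuclideanSpace ℝ (Fin 5)) 1) ((⊤ : ℕ∞) : WithTop ℕ∞))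

-- earlier ExistRicPos (stmt-SmoothPoincare4-6236, replaced 2026-08-15T16:53:21Z -> stmt-SmoothPoincare4-11180): retired by None — ∀ S : Literature.Topology.FourManifolds.HomotopySphere 4, ∃ g : Literature.Geometry.Lorentzian.PseudoRiemannianMetric (𝓡 4) ∞ (EuclideanSpace ℝ (Fin 4)) (TangentSpace (𝓡 4) : S.carrier → Type _), ∃ _ : g.HasLeviCivita, g.IsRiemannian ∧ ∀ (x : S.carrier) (v : TangentSpace 
/-- item stmt-SmoothPoincare4-11180 · crux · rank 4 · open · by planner
why it might fail: At least PSC-hard: Σ comes from S⁴ by codimension-2 surgeries (h-cobordism 3-handles, Gluck regluing) where Ric > 0 surgery (Sha–Yang, Wraith: codim ≥ 3 with extra hypotheses) is unavailable; an exotic Σ may simply carry no such metric.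
sources: ShaYang1991, Wraith1998, Hamilton1997, arXiv:2501.01113, arXiv:2507.15719
[crux] every smooth homotopy 4-sphere admits a Riemannian metric with Ric > 0 (card EXIST-RIC;
existence side, weaker pointwise than PIC/¼-pinching, stronger than the PSC crux of route PIC).
Quantified over bare homotopy 4-spheres (M Hausdorff, second countable, C^∞ 4-manifold on ℝ⁴, M ≃ₕ
S⁴) exactly as `SmoothPoincare4` does; such M is compact and orientable by the PROVED facts
compactSpace_/isOrientable_of_homotopyEquiv_sphere_four_holds, so this is equivalent to the rev-1
`HomotopySphere 4` form (folder CheckHS.lean) while keeping HomotopySpheres.lean and its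
Freedman/Smale/Kervaire–Milnor facts out of the route's cone (route-repair rev 2). [difficulty:
open-problem] -/
@[route_item "route-SmoothPoincare4-InstantonEntropy"]
def ExistRicPos : Prop :=
  ∀ (M : Type) [TopologicalSpace M] [T2Space M] [SecondCountableTopology M] [ChartedSpace (EuclideanSpace ℝ (Fin 4)) M] [IsManifold (𝓡 4) ((⊤ : ℕ∞) : WithTop ℕ∞) M], M ≃ₕ Metric.sphere (0 : EuclideanSpace ℝ (Fin 5)) 1 → ∃ g : Literature.Geometry.Lorentzian.PseudoRiemannianMetric (𝓡 4) ((⊤ : ℕ∞) : WithTop ℕ∞) (EuclideanSpace ℝ (Fin 4)) (TangentSpace (𝓡 4) : M → Type _), ∃ _ : g.HasLeviCivita, g.IsRiemannian ∧ ∀ (x : M) (v : TangentSpace (𝓡 4) x), v ≠ 0 → 0 < g.ricci x v v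

-- item stmt-SmoothPoincare4-6961 · support · rank 5 · open · by planner — informal only, no Lean statement yet:
--   [crux] LocalMinRicPos (card instanton-entropy-mountain-pass §4, LOCAL-MIN(Ric>0); informal until
--   definition request AsdModuliSpace lands). For a smooth homotopy 4-sphere Σ and a Riemannian metric g
--   on Σ with Ric_g > 0 that is generic in the Freed–Uhlenbeck sense, every critical point [A] ∈ M₁(Σ,g)
--   (charge-one g-anti-self-dual SU(2) connections modulo gauge; a smooth 5-manifold without reducibles
--   since b₂(Σ) = 0) of the instanton entropy S(A) = ∫_Σ ρ_A log ρ_A dvol_g, ρ_A = |F_A|²_g, is a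
--   NONDEGENERATE LOCAL MINIMUM: the constrained Hessian Hess S|_{T_[A]M₁}(a,a) = ∫ (δ_a ρ)²/ρ + ∫
--   (δ²_{a,a} ρ)

-- item stmt-SmoothPoincare4-6962 · support · rank 6 · open · by planner — informal only, no Lean statement yet:
--   [crux] CollarMonotone (card COLLAR-MONOTONE; the new estimate inside the platform; informal until
--   AsdModuliSpace lands). Let Σ be a smooth homotopy 4-sphere with a Freed–Uhlenbeck-generic Riemannian
--   metric g, and let Φ : Σ × (0,λ₀) → M₁(Σ,g) be the Donaldson–Taubes collar (concentrated charge-one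
--   instantons with centre x and scale λ; GordonKirby1984, Taubes' survey Thm 2.6/2.7; Donaldson1983).
--   Then the instanton entropy S(A) = ∫_Σ |F_A|² log|F_A|² dvol_g satisfies on the collar: S∘Φ is C¹
--   with S(Φ(x,λ)) = 32π² log(1/λ) + R(x,λ), |∂_λ R| ≤ C λ|log λ| and |∇_x R| ≤ C uniformly in x, for λ
--   < λ₁(g

/-- item stmt-SmoothPoincare4-6237 · support · rank 9 · open · by planner
sources: Stoll2016
[support] Möbius change of variables (Stoll (5.3.1): ∫ f∘φ_a dσ = ∫ P_h(a,·) f dσ, and J_(φ_a) =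
P_h(a,·)): for ζ in the open unit 5-ball, ⨍ K_ζ log K_ζ dσ̄ = − ⨍ log K_ζ dσ̄. Verified numerically
to 1e-12 this session; it makes Ent explicitly radial-monotone (−log K_ζ = −4 log(1−|ζ|²) + 4
log|x−ζ|², spherical mean of a subharmonic function). [difficulty: M] -/
@[route_item "route-SmoothPoincare4-InstantonEntropy"]
def RoundEntropyClosedForm : Prop :=
  let K : EuclideanSpace ℝ (Fin 5) → Metric.sphere (0 : EuclideanSpace ℝ (Fin 5)) 1 → ℝ := fun ζ x => ((1 - ‖ζ‖ ^ 2) / ‖(x : EuclideanSpace ℝ (Fin 5)) - ζ‖ ^ 2) ^ 4; ∀ ζ ∈ Metric.ball (0 : EuclideanSpace ℝ (Fin 5)) 1, (⨍ x, K ζ x * Real.log (K ζ x) ∂(volume : Measure (EuclideanSpace ℝ (Fin 5))).toSphere) = - ⨍ x, Real.log (K ζ x) ∂(volume : Measure (EuclideanSpace ℝ (Fin 5))).toSphere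

/-- item stmt-SmoothPoincare4-6238 · support · rank 9 · open · by planner
sources: Stoll2016, AtiyahHitchinSinger1978, BianchiEtAl1998
[support] ROUND case (card §2, Jensen + radial monotonicity): Ent(ζ) = ⨍ K_ζ log K_ζ dσ̄ is C² on
the open 5-ball, its only critical point there is ζ = 0, and the Hessian at 0 is positive definite
(= 12.8·Id numerically; Ent = 6.4|ζ|² + O(|ζ|⁴)). This is 'S has a unique nondegenerate critical
point on M₁(S⁴, round)'. [difficulty: M] -/
@[route_item "route-SmoothPoincare4-InstantonEntropy"]
def RoundEntropyUnique : Prop :=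
  let K : EuclideanSpace ℝ (Fin 5) → Metric.sphere (0 : EuclideanSpace ℝ (Fin 5)) 1 → ℝ := fun ζ x => ((1 - ‖ζ‖ ^ 2) / ‖(x : EuclideanSpace ℝ (Fin 5)) - ζ‖ ^ 2) ^ 4; let E : EuclideanSpace ℝ (Fin 5) → ℝ := fun ζ => ⨍ x, K ζ x * Real.log (K ζ x) ∂(volume : Measure (EuclideanSpace ℝ (Fin 5))).toSphere; ContDiffOn ℝ 2 E (Metric.ball (0 : EuclideanSpace ℝ (Fin 5)) 1) ∧ (∀ ζ ∈ Metric.ball (0 : EuclideanSpace ℝ (Fin 5)) 1, fderiv ℝ E ζ = 0 ↔ ζ = 0) ∧ ∀ v : EuclideanSpace ℝ (Fin 5), v ≠ 0 → 0 < fderiv ℝ (fderiv ℝ E) 0 v v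

/-- item stmt-SmoothPoincare4-6239 · support · rank 9 · open · by planner
sources: Stoll2016, GroisserParker1987
[support] SMALL-OSC (card §3(a)): there is c₀ > 0 such that for every continuous u on S⁴ with |u| ≤
c₀ the model entropy F_u has exactly one critical point in the open 5-ball, a nondegenerate minimum
(interior gradient/Hessian estimates for hyperbolic-harmonic extensions against the uniformly convex
radial profile of Ent; all critical points are confined to hyperbolic distance O(c₀) of 0).
[difficulty: L] -/
@[route_item "route-SmoothPoincare4-InstantonEntropy"]
def SmallOscUnique : Prop :=
  let K : EuclideanSpace ℝ (Fin 5) → Metric.sphere (0 : EuclideanSpace ℝ (Fin 5)) 1 → ℝ := fun ζ x => ((1 - ‖ζ‖ ^ 2) / ‖(x : EuclideanSpace ℝ (Fin 5)) - ζ‖ ^ 2) ^ 4; let F : (Metric.sphere (0 : EuclideanSpace ℝ (Fin 5)) 1 → ℝ) → EuclideanSpace ℝ (Fin 5) → ℝ := fun u ζ => (⨍ x, K ζ x * Real.log (K ζ x) ∂(volume : Measure (EuclideanSpace ℝ (Fin 5))).toSphere) - 4 * ⨍ x, K ζ x * u x ∂(volume : Measure (EuclideanSpace ℝ (Fin 5))).toSphere;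 ∃ c₀ : ℝ, 0 < c₀ ∧ ∀ u : Metric.sphere (0 : EuclideanSpace ℝ (Fin 5)) 1 → ℝ, Continuous u → (∀ x, |u x| ≤ c₀) → ∃ ζ₀ ∈ Metric.ball (0 : EuclideanSpace ℝ (Fin 5)) 1, fderiv ℝ (F u) ζ₀ = 0 ∧ (∀ v : EuclideanSpace ℝ (Fin 5), v ≠ 0 → 0 < fderiv ℝ (fderiv ℝ (F u)) ζ₀ v v) ∧ ∀ ζ ∈ Metric.ball (0 : EuclideanSpace ℝ (Fin 5)) 1, fderiv ℝ (F u) ζ = 0 → ζ = ζ₀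

-- item stmt-SmoothPoincare4-7012 · support · rank 9 · open · by planner — informal only, no Lean statement yet:
--   [support] EntropyModuliPlatform — the KNOWN gauge-theoretic facts the engine stands on, to be
--   vendored as cite facts once definition request AsdModuliSpace lands (informal; no conjectural
--   content). For a closed oriented smooth 4-manifold Σ with b₂(Σ) = 0 and π₁(Σ) = 1 (a homotopy
--   4-sphere) and a Freed–Uhlenbeck-generic Riemannian metric g, with M₁(Σ,g) the moduli space of
--   g-anti-self-dual connections on the SU(2)-bundle with c₂ = 1 modulo gauge: (i) M₁(Σ,g) ≠ ∅
--   (Taubes1982; GordonKirby1984 Taubes survey Thm 2.2); (ii) M₁(Σ,g) is a smooth 5-manifold and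
--   contains no reducible connections (reduct

-- item stmt-SmoothPoincare4-7057 · support · rank 9 · open · by planner — informal only, no Lean statement yet:
--   [support] MorseMountainPass — the glue of the foreseen split RicPosRecognition ⇐ CollarMonotone →
--   LocalMinRicPos → RicPosRecognition; KNOWN finite-dimensional differential topology, informal only
--   because its hypotheses mention M₁ (typable in pure Mathlib terms once regular level sets carry
--   manifold structures). Let M be a smooth connected 5-manifold without boundary, Σ a closed smooth
--   4-manifold, S : M → ℝ smooth, proper and bounded below, and Φ : Σ × (0,λ₁) → M a diffeomorphism onto
--   an open subset whose complement is compact, with ∂_λ(S∘Φ) < 0 and S∘Φ(x,λ) → +∞ as λ → 0 uniformly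
--   in x (the ou

/-- item stmt-SmoothPoincare4-6240 · assembly · rank 1 · open · by planner
sources: Donaldson1983, Hamilton1997
[assembly] ExistRicPos → RicPosRecognition → SmoothPoincare4. -/
@[route_item "route-SmoothPoincare4-InstantonEntropy"]
def Assembly : Prop :=
  ExistRicPos → RicPosRecognition → SmoothPoincare4

/-! D-0027 §2.1 — DECIDING THEOREM (planner-authored via `route open/edit --closes-file`; by planner-rrepair-SmoothPoincare4-InstantonEntro-d0a3886e-0 2026-08-15T16:53:21Z):
its hypotheses are this route's items and its conclusion the sub-problem Statement (glue_lint), and it elaborates with this file. -/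

@[closes "route-SmoothPoincare4-InstantonEntropy"] theorem closes (hE : ExistRicPos) (hR : RicPosRecognition) : _root_.SmoothPoincare4 := by
  unfold _root_.SmoothPoincare4 Literature.SPC4.SmoothPoincareConjectureFour
    ContinuousMap.HomotopyEquiv.NonemptyDiffeomorphSphere
  intro M _ _ _ _ _ e
  exact hR M e (hE M e)

end Summit.SmoothPoincare4.SmoothPoincare4.Theses.InstantonEntropy
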